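import Literature.ModelTheory.ExponentialFields.DefinablyMeager
import Literature.ModelTheory.ExponentialFields.DefinabilityParams
import HarnessLib

/-!
# Meager sets have empty interior in a definably Baire set (Fornasiero–Servi 2010, Lemma 2.5)

Topic `Literature/ModelTheory/ExponentialFields`.  A. Fornasiero – T. Servi, *Definably complete
Baire structures*, Fund. Math. 209 (2010), Lemma 2.5: for a definable `Y ⊆ Kᵐ`, "`Y` is Baire"
is equivalent to "for all `X ⊆ Y`, if `X` is meager, then `int_Y X = ∅`" and to "every residual
subset of `Y` is dense".  This file proves the two implications from "Baire" for the notions of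
`DefinablyMeager.lean`, over a linear order without endpoints carrying its order topology (so
that every open set of `Mⁿ` contains a *definable* open box around each of its points):

* `exists_box_subset_of_isOpen`, `definable_box_Ioo`, `isOpen_box_Ioo` — definable open boxes;
* **`IsDefinablyBaireIn.inter_eq_empty_of_isDefinablyMeagerIn`** — Lemma 2.5, (1) ⇒ (2): a
  definably meager subset of a definably Baire `Y` contains no non-empty relatively open subset;
* `IsDefinablyBaireIn.subset_closure_diff` — Lemma 2.5, (1) ⇒ (4): complements of definably
  meager sets ("residual" sets) are dense in `Y`.

Everything is proved; no definitions, no named facts.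

## References

* A. Fornasiero, T. Servi, *Definably complete Baire structures*, Fund. Math. 209 (2010),
  Lemma 2.5. [FornasieroServi2010]
-/

universe u v w

open Set FirstOrder FirstOrder.Language
open _root_.Filter _root_.Topology

namespace Literature.ModelTheory.ExponentialFields

variable {L : FirstOrder.Language.{u, v}} {M : Type w} [L.Structure M] {n : ℕ} [LinearOrder M]
  [TopologicalSpace M] [OrderTopology M] [NoMinOrder M] [NoMaxOrder M]

omit [L.Structure M] in
/-- **Open sets contain open boxes around their points**: if `O ⊆ Mⁿ` is open and `y ∈ O`, some
box `Π (lᵢ, uᵢ) ∋ y` lies in `O` (product of order topologies, no endpoints). [folklore] -/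
theorem exists_box_subset_of_isOpen {O : Set (Fin n → M)} (hO : IsOpen O) {y : Fin n → M}
    (hy : y ∈ O) : ∃ l u : Fin n → M, (∀ i, l i < y i ∧ y i < u i) ∧
      {x : Fin n → M | ∀ i, l i < x i ∧ x i < u i} ⊆ O := by
  classical
  have hOn : O ∈ 𝓝 y := hO.mem_nhds hy
  rw [nhds_pi] at hOn
  obtain ⟨I, -, s, hs, hIs⟩ := Filter.mem_pi.1 hOn
  have hcoord : ∀ i, ∃ l u, y i ∈ Ioo l u ∧ Ioo l u ⊆ s i := fun i =>
    mem_nhds_iff_exists_Ioo_subset.1 (hs i)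
  choose l u hylu hlus using hcoord
  refine ⟨l, u, fun i => hylu i, fun x hx => hIs fun i _ => hlus i (hx i)⟩

omit [TopologicalSpace M] [OrderTopology M] [NoMinOrder M] [NoMaxOrder M] in
/-- Open boxes with endpoints in `M` are definable (with `<` definable). [folklore] -/
theorem definable_box_Ioo (hlt : (univ : Set M).Definable L {v : Fin 2 → M | v 0 < v 1})
    (l u : Fin n → M) :
    (univ : Set M).Definable L {x : Fin n → M | ∀ i, l i < x i ∧ x i < u i} := by
  have h := definable_iInter_of_finite (L := L) (A := (univ : Set M)) fun i : Fin n =>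
    (definable_setOf_lt_params hlt (definableFun_const_params _ (mem_univ (l i)))
      (definableFun_proj_params (α := Fin n) i)).inter
    (definable_setOf_lt_params hlt (definableFun_proj_params (α := Fin n) i)
      (definableFun_const_params _ (mem_univ (u i))))
  refine (congrArg _ ?_).mpr h
  ext x
  simp only [mem_setOf_eq, mem_iInter, mem_inter_iff]

omit [L.Structure M] [NoMinOrder M] [NoMaxOrder M] in
/-- Open boxes are open. [folklore] -/
theorem isOpen_box_Ioo (l u : Fin n → M) : IsOpen {x : Fin n → M | ∀ i, l i < x i ∧ x i < u i} := by
  have h : {x : Fin n → M | ∀ i, l i < x i ∧ x i < u i} = Set.pi univ fun i => Ioo (l i) (u i) := by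
    ext x; simp
  rw [h]
  exact isOpen_set_pi finite_univ fun i _ => isOpen_Ioo

/-- **Lemma 2.5, (1) ⇒ (2)** (Fornasiero–Servi 2010): in a definably Baire `Y`, a definably
meager `X ⊆ Y` has empty relative interior — no open `O` meets `Y` inside `X`.  (A point of
`O ∩ Y` has a definable open box `B ⊆ O` around it; `B ∩ Y ⊆ X` is definably meager in `Y`,
against `Y` being Baire.) [cite: FornasieroServi2010, Lemma 2.5] -/
theorem IsDefinablyBaireIn.inter_eq_empty_of_isDefinablyMeagerIn
    (hlt : (univ : Set M).Definable L {v : Fin 2 → M | v 0 < v 1}) {Y X : Set (Fin n → M)}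
    (hB : IsDefinablyBaireIn L Y) (hX : IsDefinablyMeagerIn L Y X) {O : Set (Fin n → M)}
    (hO : IsOpen O) (hsub : O ∩ Y ⊆ X) : O ∩ Y = ∅ := by
  by_contra hne
  obtain ⟨y, hyO, hyY⟩ := nonempty_iff_ne_empty.2 hne
  obtain ⟨l, u, hy, hbox⟩ := exists_box_subset_of_isOpen hO hyO
  refine hB _ (definable_box_Ioo hlt l u) (isOpen_box_Ioo l u) ⟨y, hy, hyY⟩ ?_
  exact hX.mono fun x hx => hsub ⟨hbox hx.1, hx.2⟩

/-- **Lemma 2.5, (1) ⇒ (4)** (Fornasiero–Servi 2010: "every residual subset of `Y` is dense"):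
in a definably Baire `Y`, the complement of a definably meager set is dense in `Y`.
[cite: FornasieroServi2010, Lemma 2.5] -/
theorem IsDefinablyBaireIn.subset_closure_diff
    (hlt : (univ : Set M).Definable L {v : Fin 2 → M | v 0 < v 1}) {Y X : Set (Fin n → M)}
    (hB : IsDefinablyBaireIn L Y) (hX : IsDefinablyMeagerIn L Y X) : Y ⊆ closure (Y \ X) := by
  intro y hy
  rw [mem_closure_iff]
  intro O hO hyO
  by_contra hne
  have hsub : O ∩ Y ⊆ X := by
    intro x hx
    by_contra hxX
    exact hne ⟨x, hx.1, hx.2, hxX⟩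
  have h := hB.inter_eq_empty_of_isDefinablyMeagerIn hlt hX hO hsub
  have : y ∈ O ∩ Y := ⟨hyO, hy⟩
  rw [h] at this
  exact this

end Literature.ModelTheory.ExponentialFields
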